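/-
Origin: expansion seat `planner-pub-hodgecm-pv13-g5-0`, handover #6 2026-08-18T13:5xZ (md5 1f97a6112f6821d7356358bfd59644d1; NEW additive leaf; TWO import rewrites by the generic ^import Pv[0-9]+g[0-9]+\. rule: Pv13g5.GenuineSchrodingerRigid -> HodgeCM.PerL34.GenuineSchrodingerRigid (my #3, RUN 30 HANDOVER 13:21:50Z) and Pv07g5.GenuineSchrodingerSchwartz -> HodgeCM.PerL34.GenuineSchrodingerSchwartz (pv07-g5 #5 4de99c0c, RUN 30 HANDOVER 13:07:49Z); land AFTER bo (`HOME/pub-hodgecm-pv13-g5/lean/Pv13g5/GenuineSchrodingerSchwartzDense.lean`, md5 1f97a611, 519 lines);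
landed by the gen-8 packager in gate run 30 as `HodgeCM/PerL34/GenuineSchrodingerSchwartzDense.lean` (import ^import Pv07g5\.GenuineSchrodingerSchwartz[ \t]*$→import HodgeCM.PerL34.GenuineSchrodingerSchwartz ×1; import ^import Pv13g5\.GenuineSchrodingerRigid[ \t]*$→import HodgeCM.PerL34.GenuineSchrodingerRigid ×1).
-/
/-
Copyright (c) 2026. All rights reserved.
Released under Apache 2.0 license as described in the file LICENSE.

# Density and Heisenberg stability of the Schwartz–Bruhat space `𝒮(X) ⊂ L²(X)`

(`HodgeCM/PerL34/GenuineSchrodingerSchwartzDense.lean`; seam S3, 𝓕-side; additive kernel leaf on top of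
pv07-g5's `GenuineSchrodingerSchwartz` (the subspace `Coeff.schwartzBruhat L` = span of the indicator
vectors `indCO L A` of compact open `A ⊆ X`, its `rep`-stability, `φ_e ∈ 𝒮(X)`) and of
`GenuineSchrodingerRigid` (the level balls `B_k`).)

`X = X_split = ∏'_{v split} ((L⁺_v)³ : 𝒪_v³)` is a locally compact, totally disconnected abelian
group, so its Schwartz–Bruhat space is the space of locally constant, compactly supported functions
(Bruhat 1961 §9; Weil 1964 nos. 11, 29; MVW ch. 2, I.3).  This file proves, in the kernel and citing
nothing, the three facts about `𝒮(X) ⊂ L²(X)` that the model uses and that `GenuineSchrodingerSchwartz`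
leaves open:

* §1 compact-open geometry of `X`: every neighbourhood of a point contains a level-ball coset
  `x + B_k`, and between a compact `K` and an open `U ⊇ K` there is a COMPACT OPEN `C`
  (`exists_compactOpen_between`) — `X` has a basis of compact open sets;
* §2 **the two definitions agree** (`Coeff.mem_schwartzBruhat_iff`): a class lies in the span of the
  compact-open indicator vectors iff it has a locally constant, compactly supported representative
  (`IsSchwartzBruhat`) — print's definition of `𝒮(X)`;
* §3 **Heisenberg stability**: `𝒮(X)` is stable under the translations `τ_y` and under modulation
  by every continuous additive unitary character of `X` (these are locally constant: a continuous
  character kills a level ball, by the no-small-subgroups property of `S¹`, `NoSmallSubgroups`) —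
  with pv07-g5's `schwartzBruhat_stable` (the Levi operators `rep L ν k`) the whole Heisenberg–Levi
  action of the model preserves `𝒮(X)` (`Coeff.rep_translate_modulate_mem_schwartzBruhat`);
* §4 **density**: `𝒮(X)` is dense in `L²(X)` (`Coeff.dense_schwartzBruhat`,
  `Coeff.topologicalClosure_schwartzBruhat`), by inner/outer regularity of the Haar measure `μ` and
  §1; more generally any subspace containing the compact-open indicator vectors is dense, and two
  bounded operators on `L²(X)` agreeing on the vectors `1_A` (`A` compact open) are equal
  (`Coeff.clm_eq_of_eqOn_indCO`) — operator identities of the model need only be checked on `𝒮(X)`.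

Dictionary value (PerL v5 §3(c), ll. 291–314: "φ = ⊗ φ_v ∈ 𝒮((V₃ ⊗ W)(𝔸))"; ll. 259–263: the Weil
representation acts on the Schwartz–Bruhat space, a dense subspace of the unitary model): the
subspace on which pv07-g5's END `…_genuine_schwartzEmbed` is fed is print's `𝒮(X)`, it is dense in
the Hilbert space of the genuine model, and it is a common invariant core for all operators of the
model.

Nothing is left unproved and no axiom is added: every theorem depends only on
`[propext, Classical.choice, Quot.sound]`.
-/
import Summits.HodgeConjecture.HodgeCM.PerL34.GenuineSchrodingerRigid_2
import Summits.HodgeConjecture.HodgeCM.PerL34.GenuineSchrodingerSchwartz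

set_option autoImplicit false

noncomputable section

open MeasureTheory MeasureTheory.Measure Set Metric Function Complex Topology Filter
open scoped RestrictedProduct InnerProductSpace NNReal ENNReal Pointwise

namespace HodgeCM.PerL34.PureTensor.SchrodingerModel

open HodgeCM.PerL34.LocalFactors HodgeCM.PerL34.LocalFactors.DilationModel
open HodgeCM.PerL34.LocalFactors.SchrodingerLevi
open HodgeCM.PerL34.IdelePlaces HodgeCM.PerL34.IdelicTorusModel HodgeCM.PerL34.IdelicTorusModel.Genuine
open NumberField IsDedekindDomain

attribute [local instance] LocalFactors.DilationModel.Adic.nontriviallyNormedField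
  LocalFactors.DilationModel.Adic.properSpace

variable {L : Type} [Field L] [NumberField L] [IsCMField L]

/-! ## §1  Compact-open geometry of `X` -/

variable (L) in
/-- the level-ball coset `x + B_k` -/
def ballCoset (x : Space L) (k : ℕ) : Set (Space L) :=
  (fun v : Space L => x + v) '' (levelBall L k : Set (Space L))

/-- (Ported verbatim from the HodgeCMPerL package; no docstring in the source.) -/
theorem mem_ballCoset_self (x : Space L) (k : ℕ) : x ∈ ballCoset L x k :=
  ⟨0, (levelBall L k).zero_mem, add_zero x⟩

/-- (Ported verbatim from the HodgeCMPerL package; no docstring in the source.) -/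
theorem isOpen_ballCoset (x : Space L) (k : ℕ) : IsOpen (ballCoset L x k) :=
  (Homeomorph.addLeft x).isOpenMap _ (isOpen_levelBall L k)

/-- (Ported verbatim from the HodgeCMPerL package; no docstring in the source.) -/
theorem isCompact_ballCoset (x : Space L) (k : ℕ) : IsCompact (ballCoset L x k) :=
  (isCompact_levelBall L k).image (Homeomorph.addLeft x).continuous

/-- (Ported verbatim from the HodgeCMPerL package; no docstring in the source.) -/
theorem ballCoset_mem_nhds (x : Space L) (k : ℕ) : ballCoset L x k ∈ 𝓝 x :=
  (isOpen_ballCoset x k).mem_nhds (mem_ballCoset_self x k)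

/-- every neighbourhood of a point contains a level-ball coset of the point: the cosets `x + B_k`
form a neighbourhood basis of `x` consisting of compact open sets -/
theorem exists_ballCoset_subset {U : Set (Space L)} {x : Space L} (hU : U ∈ 𝓝 x) :
    ∃ k, ballCoset L x k ⊆ U := by
  have h0 : {v : Space L | x + v ∈ U} ∈ 𝓝 (0 : Space L) := by
    have hc : Continuous fun v : Space L => x + v := continuous_const.add continuous_id
    exact hc.continuousAt.preimage_mem_nhds (by simpa only [add_zero] using hU)
  obtain ⟨k, hk⟩ := levelBall_nhds L _ h0
  refine ⟨k, ?_⟩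
  rintro _ ⟨v, hv, rfl⟩
  exact hk hv

/-- **`X` has a basis of compact open sets**: between a compact set and an open set containing it
there is a compact open set. -/
theorem exists_compactOpen_between {K U : Set (Space L)} (hK : IsCompact K) (hU : IsOpen U)
    (hKU : K ⊆ U) : ∃ C : Set (Space L), IsCompact C ∧ IsOpen C ∧ K ⊆ C ∧ C ⊆ U := by
  classical
  -- a level for every point of `U`
  have hex : ∀ x ∈ U, ∃ k, ballCoset L x k ⊆ U := fun x hx =>
    exists_ballCoset_subset (hU.mem_nhds hx)
  let kf : Space L → ℕ := fun x => if hx : x ∈ U then (hex x hx).choose else 0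
  have hkf : ∀ x ∈ U, ballCoset L x (kf x) ⊆ U := fun x hx => by
    simp only [kf, dif_pos hx]; exact (hex x hx).choose_spec
  obtain ⟨t, htK, hcover⟩ :=
    hK.elim_nhds_subcover (fun x => ballCoset L x (kf x)) fun x _ => ballCoset_mem_nhds x (kf x)
  refine ⟨⋃ x ∈ t, ballCoset L x (kf x), t.isCompact_biUnion fun x _ => isCompact_ballCoset x _,
    isOpen_biUnion fun x _ => isOpen_ballCoset x _, hcover, ?_⟩
  exact Set.iUnion₂_subset fun x hx => hkf x (hKU (htK x hx))

/-! ## §2  Schwartz–Bruhat functions and the two definitions of `𝒮(X)` -/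

/-- a **Schwartz–Bruhat function** on the totally disconnected group `X`: locally constant with
compact support (Bruhat; Weil 1964 no. 11) -/
def IsSchwartzBruhat (g : Space L → ℂ) : Prop :=
  IsLocallyConstant g ∧ HasCompactSupport g

namespace IsSchwartzBruhat

/-- (Ported verbatim from the HodgeCMPerL package; no docstring in the source.) -/
theorem zero : IsSchwartzBruhat (L := L) 0 :=
  ⟨IsLocallyConstant.const (0 : ℂ), HasCompactSupport.zero⟩

/-- (Ported verbatim from the HodgeCMPerL package; no docstring in the source.) -/
theorem add {g g' : Space L → ℂ} (hg : IsSchwartzBruhat g) (hg' : IsSchwartzBruhat g') :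
    IsSchwartzBruhat (g + g') :=
  ⟨hg.1.add hg'.1, hg.2.add hg'.2⟩

/-- (Ported verbatim from the HodgeCMPerL package; no docstring in the source.) -/
theorem smul {g : Space L → ℂ} (c : ℂ) (hg : IsSchwartzBruhat g) : IsSchwartzBruhat (c • g) :=
  ⟨hg.1.comp (c • ·), hg.2.smul_left (f := fun _ => c)⟩

/-- multiplication by a locally constant function preserves `𝒮(X)` -/
theorem mul_left {g c : Space L → ℂ} (hc : IsLocallyConstant c) (hg : IsSchwartzBruhat g) :
    IsSchwartzBruhat (c * g) :=
  ⟨hc.mul hg.1, hg.2.mul_left⟩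

/-- composition with a homeomorphism preserves `𝒮(X)` -/
theorem comp_homeomorph {g : Space L → ℂ} (hg : IsSchwartzBruhat g) (φ : Space L ≃ₜ Space L) :
    IsSchwartzBruhat (g ∘ φ) :=
  ⟨hg.1.comp_continuous φ.continuous, hg.2.comp_homeomorph φ⟩

/-- (Ported verbatim from the HodgeCMPerL package; no docstring in the source.) -/
theorem continuous {g : Space L → ℂ} (hg : IsSchwartzBruhat g) : Continuous g := hg.1.continuous

/-- (Ported verbatim from the HodgeCMPerL package; no docstring in the source.) -/
theorem memLp {g : Space L → ℂ} (hg : IsSchwartzBruhat g) : MemLp g 2 (μ L) :=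
  hg.continuous.memLp_of_hasCompactSupport hg.2

/-- the indicator function of a compact open set (times a constant) is Schwartz–Bruhat -/
theorem indicator_const {C : Set (Space L)} (hC : IsCompact C) (hCo : IsOpen C) (c : ℂ) :
    IsSchwartzBruhat (C.indicator fun _ => c) := by
  refine ⟨(IsLocallyConstant.iff_exists_open _).2 fun x => ?_, HasCompactSupport.intro hC fun x hx => ?_⟩
  · by_cases hx : x ∈ C
    · exact ⟨C, hCo, hx, fun y hy => by rw [indicator_of_mem hy, indicator_of_mem hx]⟩
    · exact ⟨Cᶜ, hC.isClosed.isOpen_compl, hx, fun y hy =>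
        by rw [indicator_of_notMem hy, indicator_of_notMem hx]⟩
  · exact indicator_of_notMem hx _

end IsSchwartzBruhat


/-- a finite sum of classes in `L²` is represented by the pointwise sum of representatives -/
theorem coeFn_finset_sum_Lp {ι : Type*} (s : Finset ι) (F : ι → Lp ℂ 2 (μ L)) :
    ⇑(∑ i ∈ s, F i) =ᵐ[μ L] fun x => ∑ i ∈ s, (F i : Space L → ℂ) x := by
  classical
  induction s using Finset.induction_on with
  | empty =>
    simp only [Finset.sum_empty]
    exact Lp.coeFn_zero ℂ 2 (μ L)
  | insert a s ha ih =>
    simp only [Finset.sum_insert ha]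
    exact (Lp.coeFn_add _ _).trans (ih.mono fun x hx => by rw [Pi.add_apply, hx])

/-- a Schwartz–Bruhat function takes finitely many values -/
theorem IsSchwartzBruhat.range_finite {g : Space L → ℂ} (hg : IsSchwartzBruhat g) :
    (Set.range g).Finite := by
  have hK : IsCompact (tsupport g) := hg.2
  haveI : CompactSpace (tsupport g) := isCompact_iff_compactSpace.mp hK
  have hfin : (Set.range (g ∘ ((↑) : tsupport g → Space L))).Finite :=
    (hg.1.comp_continuous continuous_subtype_val).range_finite
  refine (hfin.insert (0 : ℂ)).subset ?_
  rintro _ ⟨x, rfl⟩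
  by_cases hx : x ∈ tsupport g
  · exact Or.inr ⟨⟨x, hx⟩, rfl⟩
  · exact Or.inl (image_eq_zero_of_notMem_tsupport hx)

/-- the non-zero fibres of a Schwartz–Bruhat function are compact open -/
theorem IsSchwartzBruhat.isCompact_fiber {g : Space L → ℂ} (hg : IsSchwartzBruhat g) {c : ℂ}
    (hc : c ≠ 0) : IsCompact {x | g x = c} := by
  refine hg.2.of_isClosed_subset (hg.1.isClosed_fiber c) fun x hx => subset_tsupport g ?_
  rw [Function.mem_support, show g x = c from hx]
  exact hc

/-- (Ported verbatim from the HodgeCMPerL package; no docstring in the source.) -/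
theorem IsSchwartzBruhat.isOpen_fiber {g : Space L → ℂ} (hg : IsSchwartzBruhat g) (c : ℂ) :
    IsOpen {x | g x = c} :=
  hg.1.isOpen_fiber c

/-- **a Schwartz–Bruhat function is a finite combination of indicators of compact open sets**:
`g = ∑_{c ∈ g(X) ∖ {0}} c · 1_{g = c}` -/
theorem IsSchwartzBruhat.eq_sum_indicator {g : Space L → ℂ} (hg : IsSchwartzBruhat g) (x : Space L) :
    g x = ∑ c ∈ (hg.range_finite.toFinset.erase 0), ({y | g y = c} : Set (Space L)).indicator
      (fun _ => c) x := by
  classical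
  by_cases h0 : g x = 0
  · rw [h0, eq_comm]
    refine Finset.sum_eq_zero fun c hc => ?_
    rw [Finset.mem_erase] at hc
    rw [indicator_of_notMem]
    intro hx
    exact hc.1 (by rw [← show g x = c from hx, h0])
  · rw [Finset.sum_eq_single (g x)]
    · rw [Set.indicator_of_mem (s := {y | g y = g x}) (f := fun _ => g x) rfl]
    · intro c _ hcx
      exact Set.indicator_of_notMem (fun hx : g x = c => hcx hx.symm) (fun _ => c)
    · intro hnot
      exact absurd (Finset.mem_erase.2 ⟨h0, hg.range_finite.mem_toFinset.2 ⟨x, rfl⟩⟩) hnot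

/-- a continuous additive unitary character of `X` kills a level ball (no small subgroups in `S¹`,
`NoSmallSubgroups`; PerL v5 ll. 623–625) -/
theorem exists_levelBall_char_eq_one (χ : C(Space L, Circle))
    (hχ : ∀ u v, χ (u + v) = χ u * χ v) : ∃ k, ∀ u ∈ levelBall L k, χ u = 1 := by
  have hχ0 : χ 0 = 1 := by
    have h := hχ 0 0
    rw [add_zero] at h
    exact left_eq_mul.mp h
  obtain ⟨k, hk⟩ := levelBall_nhds L ((χ : Space L → Circle) ⁻¹' {z : Circle | 0 < (z : ℂ).re}) (by
    apply (IsOpen.preimage χ.continuous _).mem_nhds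
    · show 0 < ((χ 0 : Circle) : ℂ).re
      rw [hχ0]; simp
    · exact isOpen_lt continuous_const (Complex.continuous_re.comp continuous_subtype_val))
  -- the image `χ(B_k)` is a subgroup of `S¹` inside the right half plane, hence trivial
  let H : Subgroup Circle :=
    { carrier := (χ : Space L → Circle) '' (levelBall L k : Set (Space L))
      one_mem' := ⟨0, (levelBall L k).zero_mem, hχ0⟩
      mul_mem' := by
        rintro _ _ ⟨u, hu, rfl⟩ ⟨v, hv, rfl⟩
        exact ⟨u + v, (levelBall L k).add_mem hu hv, hχ u v⟩
      inv_mem' := by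
        rintro _ ⟨u, hu, rfl⟩
        refine ⟨-u, (levelBall L k).neg_mem hu, ?_⟩
        have h := hχ u (-u)
        rw [add_neg_cancel, hχ0] at h
        exact eq_inv_of_mul_eq_one_right h.symm }
  have hH : H = ⊥ :=
    NoSmallSubgroups.Circle.subgroup_eq_bot_of_forall_re_pos H (by
      rintro _ ⟨u, hu, rfl⟩
      exact hk hu)
  refine ⟨k, fun u hu => ?_⟩
  have hmem : χ u ∈ H := ⟨u, hu, rfl⟩
  rw [hH, Subgroup.mem_bot] at hmem
  exact hmem

/-- hence **a continuous additive unitary character of `X` is locally constant** -/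
theorem isLocallyConstant_char (χ : C(Space L, Circle)) (hχ : ∀ u v, χ (u + v) = χ u * χ v) :
    IsLocallyConstant (fun u => ((χ u : Circle) : ℂ)) := by
  obtain ⟨k, hk⟩ := exists_levelBall_char_eq_one χ hχ
  refine (IsLocallyConstant.iff_exists_open _).2 fun x => ⟨ballCoset L x k, isOpen_ballCoset x k,
    mem_ballCoset_self x k, ?_⟩
  rintro _ ⟨v, hv, rfl⟩
  rw [hχ x v, hk v hv, mul_one]


namespace Coeff

/-! ### The span of the compact-open indicator vectors (`GenuineSchrodingerSchwartz`) consists exactly of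
the classes of Schwartz–Bruhat functions -/

/-- `c · 1_A` as an indicator vector: `indicatorConstLp 2 _ _ c = c • indCO L A` -/
theorem indicatorConstLp_eq_smul_indCO {A : Set (Space L)} (hA : IsCompact A) (hA' : IsOpen A)
    (hm : MeasurableSet A) (hμ : μ L A ≠ ∞) (c : ℂ) :
    indicatorConstLp 2 hm hμ c = c • indCO L A hA hA' := by
  apply Lp.ext
  have h1 : (indCO L A hA hA' : Space L → ℂ) =ᵐ[μ L] A.indicator fun _ => (1 : ℂ) :=
    indicatorConstLp_coeFn
  refine indicatorConstLp_coeFn.trans (Filter.EventuallyEq.trans ?_ (Lp.coeFn_smul c _).symm)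
  filter_upwards [h1] with x hx
  rw [Pi.smul_apply, hx]
  by_cases hxA : x ∈ A <;> simp [hxA]

/-- every vector `c · 1_A`, `A` compact open, lies in `𝒮(X)` -/
theorem indicatorConstLp_mem_schwartzBruhat {A : Set (Space L)} (hA : IsCompact A) (hA' : IsOpen A)
    (hm : MeasurableSet A) (hμ : μ L A ≠ ∞) (c : ℂ) :
    indicatorConstLp 2 hm hμ c ∈ schwartzBruhat L := by
  rw [indicatorConstLp_eq_smul_indCO hA hA' hm hμ c]
  exact Submodule.smul_mem _ c (Submodule.subset_span ⟨⟨A, hA, hA'⟩, rfl⟩)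

/-- the class of a Schwartz–Bruhat function lies in the span of the compact-open indicator vectors -/
theorem mem_schwartzBruhat_of_ae_eq {f : Lp ℂ 2 (μ L)} {g : Space L → ℂ} (hg : IsSchwartzBruhat g)
    (hfg : (f : Space L → ℂ) =ᵐ[μ L] g) : f ∈ schwartzBruhat L := by
  classical
  set F : Finset ℂ := hg.range_finite.toFinset.erase 0 with hF
  have hc0 : ∀ c ∈ F, c ≠ 0 := fun c hc => (Finset.mem_erase.1 hc).1
  -- the indicator vectors of the non-zero fibres
  let T : ℂ → Lp ℂ 2 (μ L) := fun c =>
    if hc : c ≠ 0 then indicatorConstLp 2 (hg.isOpen_fiber c).measurableSet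
      (hg.isCompact_fiber hc).measure_lt_top.ne c else 0
  have hT : ∀ c ∈ F, T c ∈ schwartzBruhat L := fun c hc => by
    simp only [T, dif_pos (hc0 c hc)]
    exact indicatorConstLp_mem_schwartzBruhat (hg.isCompact_fiber (hc0 c hc)) (hg.isOpen_fiber c) _ _ c
  have hsum : f = ∑ c ∈ F, T c := by
    apply Lp.ext
    refine hfg.trans (Filter.EventuallyEq.trans ?_ (coeFn_finset_sum_Lp F T).symm)
    have hae : ∀ c ∈ F, (T c : Space L → ℂ) =ᵐ[μ L] ({y | g y = c} : Set (Space L)).indicator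
        fun _ => c := fun c hc => by
      simp only [T, dif_pos (hc0 c hc)]
      exact indicatorConstLp_coeFn
    have hall : ∀ᵐ x ∂(μ L), ∀ c ∈ F, (T c : Space L → ℂ) x =
        ({y | g y = c} : Set (Space L)).indicator (fun _ => c) x :=
      (Filter.eventually_all_finset F).2 fun c hc => hae c hc
    filter_upwards [hall] with x hx
    rw [hg.eq_sum_indicator x, ← hF]
    exact Finset.sum_congr rfl fun c hc => (hx c hc).symm
  rw [hsum]
  exact Submodule.sum_mem _ hT

/-- **the two definitions of `𝒮(X)` agree**: a class of `L²(X)` lies in the span of the indicator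
vectors of compact open sets (`GenuineSchrodingerSchwartz.schwartzBruhat`) iff it has a locally constant,
compactly supported representative (print's Schwartz–Bruhat functions; Bruhat, Weil 1964 no. 11) -/
theorem mem_schwartzBruhat_iff {f : Lp ℂ 2 (μ L)} :
    f ∈ schwartzBruhat L ↔ ∃ g : Space L → ℂ, IsSchwartzBruhat g ∧ (f : Space L → ℂ) =ᵐ[μ L] g := by
  refine ⟨fun hf => ?_, fun ⟨g, hg, hfg⟩ => mem_schwartzBruhat_of_ae_eq hg hfg⟩
  induction hf using Submodule.span_induction with
  | mem f hf =>
    obtain ⟨⟨A, hA, hA'⟩, rfl⟩ := hf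
    exact ⟨A.indicator fun _ => 1, IsSchwartzBruhat.indicator_const hA hA' 1, indicatorConstLp_coeFn⟩
  | zero => exact ⟨0, IsSchwartzBruhat.zero, Lp.coeFn_zero ℂ 2 (μ L)⟩
  | add f f' _ _ hf hf' =>
    obtain ⟨g, hg, hfg⟩ := hf
    obtain ⟨g', hg', hfg'⟩ := hf'
    exact ⟨g + g', hg.add hg', (Lp.coeFn_add f f').trans (hfg.add hfg')⟩
  | smul c f _ hf =>
    obtain ⟨g, hg, hfg⟩ := hf
    refine ⟨c • g, hg.smul c, (Lp.coeFn_smul c f).trans ?_⟩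
    filter_upwards [hfg] with u hu
    simp only [Pi.smul_apply, hu]

/-- the class of a Schwartz–Bruhat function, as a vector of `𝒮(X)` -/
theorem toLp_mem_schwartzBruhat {g : Space L → ℂ} (hg : IsSchwartzBruhat g) :
    hg.memLp.toLp g ∈ schwartzBruhat L :=
  mem_schwartzBruhat_of_ae_eq hg (MemLp.coeFn_toLp _)

/-! ## §3  Stability under the Heisenberg–Levi action -/

/-- **translation stability**: `τ_y 𝒮(X) ⊆ 𝒮(X)` for every `y ∈ X` -/
theorem translate_mem_schwartzBruhat (y : Space L) {f : Lp ℂ 2 (μ L)} (hf : f ∈ schwartzBruhat L) :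
    translate (μ L) y f ∈ schwartzBruhat L := by
  obtain ⟨g, hg, hfg⟩ := mem_schwartzBruhat_iff.1 hf
  refine mem_schwartzBruhat_of_ae_eq (hg.comp_homeomorph (Homeomorph.addRight y))
    ((coeFn_translate (μ L) y f).trans ?_)
  exact (measurePreserving_add_right (μ L) y).quasiMeasurePreserving.ae_eq_comp hfg

/-- **modulation stability**: modulation by a continuous additive unitary character of `X` (in
particular by the adelic Heisenberg characters `u ↦ ψ_𝔸(⟨ξ, u⟩)` of `GenuineSchrodingerHeisenberg` and
by the coordinate characters `ψ_v(s·u_{v,j})` of the model) preserves `𝒮(X)` -/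
theorem modulate_mem_schwartzBruhat (χ : C(Space L, Circle)) (hχ : ∀ u v, χ (u + v) = χ u * χ v)
    {f : Lp ℂ 2 (μ L)} (hf : f ∈ schwartzBruhat L) : modulate (μ L) χ f ∈ schwartzBruhat L := by
  obtain ⟨g, hg, hfg⟩ := mem_schwartzBruhat_iff.1 hf
  refine mem_schwartzBruhat_of_ae_eq (hg.mul_left (isLocallyConstant_char χ hχ))
    ((coeFn_modulate (μ L) χ f).trans ?_)
  filter_upwards [hfg] with u hu
  rw [hu]
  rfl

/-- Levi stability via representatives: `rep L ν k 𝒮(X) ⊆ 𝒮(X)` (this is pv07-g5's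
`schwartzBruhat_stable`, re-derived from §2 so that it is stated without the local-field
measurability instances of the `Coeff` section of `GenuineSchrodingerShift`) -/
theorem rep_mem_schwartzBruhat (ν : Model L →* Circle) (k : Model L) {f : Lp ℂ 2 (μ L)}
    (hf : f ∈ schwartzBruhat L) : rep L ν k f ∈ schwartzBruhat L := by
  obtain ⟨g, hg, hfg⟩ := mem_schwartzBruhat_iff.1 hf
  have hsb : IsSchwartzBruhat fun x => weight (Space L) ν k * g (k • x) :=
    (hg.comp_homeomorph (Homeomorph.smul k)).mul_left (IsLocallyConstant.const _)
  refine mem_schwartzBruhat_of_ae_eq hsb ((coeFn_dilationRep (μ L) ν k f).trans ?_)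
  have h := (quasiMeasurePreserving_smul' (μ L) k).ae_eq_comp hfg
  filter_upwards [h] with x hx
  simp only [Function.comp_apply] at hx
  rw [hx]


-- port_pkg: scope closed for this part
end Coeff
end HodgeCM.PerL34.PureTensor.SchrodingerModel
end
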